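import Literature.NumberTheory.Sieve.GreenTao2008
import HarnessLib

/-!
# Green–Tao (2008), §9: the Goldston–Yıldırım majorant (decomposition of Proposition 9.1)

Trunk T-SIEVE. Companion of `Literature.NumberTheory.Sieve.GreenTao2008`, which reduced
Green–Tao's Theorem 1.1 (`Literature.NumberTheory.Sieve.exists_prime_arithmetic_progression`) to three named facts,
one of them being **Proposition 9.1** (`Literature.NumberTheory.Sieve.GreenTao2008.PseudorandomMajorant`: a
`k`-pseudorandom measure majorising `k⁻¹ 2^{-k-5} Λ̃` on `[ε_k N, 2ε_k N]`). This file decomposes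
Proposition 9.1 along the printed proof (B. Green, T. Tao, Ann. of Math. 167 (2008), §9,
pp. 524–530):

* real definitions: the Goldston–Yıldırım truncated divisor sum
  `truncatedDivisorSum R n = Λ_R(n) = ∑_{d ∣ n, d ≤ R} μ(d) log(R/d)` (Def. 9.2, on `n ∈ ℤ`),
  the level `gyLevel k N = R = N^{k⁻¹ 2^{-k-4}}` and the measure
  `gtMeasure k w N : ℤ/Nℤ → ℝ`, `ν(n) = (φ(W)/W) Λ_R(W n + 1)² / log R` for
  `ε_k N ≤ n ≤ 2 ε_k N` and `ν(n) = 1` otherwise (Def. 9.3; `W = ∏_{p ≤ w(N)} p`);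
* named facts (`def … : Prop`, cited): the two Goldston–Yıldırım correlation estimates
  `GoldstonYildirimLinearForms` (Prop. 9.5) and `GoldstonYildirimCorrelations` (Prop. 9.6) —
  proved in §10 and the Appendix of the source by a contour-integral evaluation involving `ζ`
  (not attempted here) — and their two consequences for `ν`, `MeasureLinearForms` (Prop. 9.8:
  `ν` satisfies the `(k 2^{k-1}, 3k-4, k)`-linear forms condition) and `MeasureCorrelation`
  (Prop. 9.10: `ν` satisfies the `2^{k-1}`-correlation condition), whose printed proofs
  (localisation to `Q^t` boxes and "nice" boxes, pp. 526–528; Lemma 9.9 and the divisor bound,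
  pp. 528–530) are the subject of the sibling PROOFS file;
* proved here: **Lemma 9.4** (`gtMeasure_nonneg`, `gtMeasure_majorises`: `ν ≥ 0`, and
  `ν(n) ≥ k⁻¹ 2^{-k-5} Λ̃(n)` on the window once `W ≤ N`, which holds for `w ≤ ⌊log_4 N⌋`), the
  evaluation `truncatedDivisorSum_prime` (`Λ_R(p) = log R` for a prime `p > R`, the heart of
  Lemma 9.4), and the **assembly of Proposition 9.1**
  (`PseudorandomMajorant_of : MeasureLinearForms → MeasureCorrelation → PseudorandomMajorant`,
  "Proof of Proposition 9.1", p. 530: "immediate from Lemmas 9.4 and 9.7, Propositions 9.8 and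
  9.10 and … Definition 3.3"; Lemma 9.7, `E(ν) = 1 + o(1)`, is the case `m = t = 1` of the
  linear forms condition and is not a separate hypothesis in our `IsPseudorandom`).

So after this file `PseudorandomMajorant` rests on exactly `MeasureLinearForms` and
`MeasureCorrelation`, which in turn rest (sibling PROOFS file) on the two Goldston–Yıldırım
named facts.

## Design choices

* "`w(N)` sufficiently slowly growing in `N`" (Props. 9.5, 9.6, Lemma 9.4) is rendered exactly as
  in `PseudorandomMajorant`: a growth bound `G → ∞` (depending on the fixed parameters
  `k, m, t`) below which every `w → ∞` is admissible.
* Props. 9.5/9.6 carry the standing assumptions of §9: `k ≥ 3` (Def. 9.3's `R = N^{k⁻¹2^{-k-4}}`;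
  for `k = 0` one would have `R = 1`, `Λ_R ≡ 0` and the asymptotic would be false) and `N` prime
  (the only consumers, Defs. 3.1/3.2, live on `ℤ_N` with `N` prime).
* Prop. 9.5 is stated for integer points of boxes `∏_j [a_j, a_j + ℓ_j)` with integer corners
  and side lengths `ℓ_j ≥ R^{10m}` (the lattice points of a product of real intervals of length
  `≥ R^{10m}` — a special case of the printed hypothesis), with the `o_{m,t}(1)` uniform in the
  coefficients `|L_{ij}| ≤ √(w(N))/2` (the printed bound, which is what Lemma 10.1 uses: two
  distinct such rationals stay distinct modulo every `p > w(N)`), the constants `b_i ∈ ℤ` and the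
  position of the box, as the proof in §10 provides and as the application in Prop. 9.8 requires
  (p. 527 and footnote 22).
  The forms `θ_i = W ψ_i + 1` may take nonpositive values on such boxes; `Λ_R` is defined on
  all of `ℤ` through divisibility by positive `d ≤ R` (so `Λ_R(-n) = Λ_R(n)`), which is how
  (10.1) reads it.
* In Prop. 9.6 the factor `∏_{p ∣ Δ} (1 + O_m(p^{-1/2}))` is rendered with an explicit constant
  `C` (allowed to depend on `k` and `m`): `∏_{p ∣ Δ} (1 + C p^{-1/2})`.
* The level `R = N^{k⁻¹2^{-k-4}}` of Def. 9.3 is kept inside Props. 9.5/9.6 (parameter `k`),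
  rather than an arbitrary `R`, to stay with what §10 proves and §9 uses.

## References

* B. Green, T. Tao, *The primes contain arbitrarily long arithmetic progressions*, Ann. of
  Math. (2) 167 (2008), 481–547: Def. 9.2, Def. 9.3 (p. 524), Lemma 9.4, Prop. 9.5 (p. 525),
  Prop. 9.6, Lemma 9.7, Prop. 9.8 (p. 526), Lemma 9.9 (p. 528), Prop. 9.10 (p. 529), proof of
  Prop. 9.1 (p. 530). [cite: GreenTaoAnnals2008]
* D. Goldston, C. Y. Yıldırım, *Higher correlations of divisor sums related to primes I, III*
  (GT refs. [15], [17]) — the origin of Props. 9.5/9.6.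
-/

noncomputable section

open Filter Finset Topology
open scoped BigOperators

namespace Literature.NumberTheory.Sieve.GreenTao2008

/-! ### Definitions 9.2 and 9.3 -/

/-- **Green–Tao 2008, Definition 9.2 (Goldston–Yıldırım truncated divisor sum).**
`Λ_R(n) = ∑_{d ∣ n, d ≤ R} μ(d) log(R/d)` (`d` a positive integer; for `d ≤ R`,
`log(R/d) = log(R/d)₊`). Defined for `n ∈ ℤ` (only divisibility is used, so
`Λ_R(-n) = Λ_R(n)` and `Λ_R(0) = ∑_{d ≤ R} μ(d) log(R/d)`), because the forms `θ_i = Wψ_i + 1`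
of Prop. 9.5 take negative values on the boxes of Prop. 9.8. For `n ≥ 1` this is the case
`H = {0}`, `ℓ = 0` of the tree's `Literature.GPY.lambdaR R {0} 0 n` (Goldston–Pintz–Yıldırım (2.13),
file `GoldstonPintzYildirim`, `ℕ`-domain via `Nat.divisors`); the two should eventually be
bridged by `truncatedDivisorSum R n = lambdaR R {0} 0 n` (`1 ≤ n`).
[cite: GreenTaoAnnals2008, Definition 9.2] -/
def truncatedDivisorSum (R : ℝ) (n : ℤ) : ℝ :=
  ∑ d ∈ (Icc 1 ⌊R⌋₊).filter (fun d : ℕ => (d : ℤ) ∣ n),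
    (ArithmeticFunction.moebius d : ℝ) * Real.log (R / d)

/-- **Green–Tao 2008, Definition 9.3: the level `R = N^{k⁻¹ 2^{-k-4}}`.**
[cite: GreenTaoAnnals2008, Definition 9.3] -/
def gyLevel (k N : ℕ) : ℝ :=
  (N : ℝ) ^ ((k : ℝ)⁻¹ * 2⁻¹ ^ (k + 4))

/-- **Green–Tao 2008, Definition 9.3: the majorant `ν`.** With `R = N^{k⁻¹2^{-k-4}}`,
`ε_k = 1/(2^k (k+4)!)`, `W = ∏_{p ≤ w(N)} p`:
`ν(n) = (φ(W)/W) Λ_R(W n + 1)² / log R` if `ε_k N ≤ n ≤ 2 ε_k N` and `ν(n) = 1` otherwise,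
for `0 ≤ n < N` identified with `ℤ_N` (via `ZMod.val`). A family in `N` with parameters `k` and
the cutoff function `w`. [cite: GreenTaoAnnals2008, Definition 9.3] -/
def gtMeasure (k : ℕ) (w : ℕ → ℕ) (N : ℕ) (x : ZMod N) : ℝ :=
  if eps k * N ≤ (x.val : ℝ) ∧ (x.val : ℝ) ≤ 2 * eps k * N then
    (Nat.totient (primorial (w N)) : ℝ) / primorial (w N) *
      truncatedDivisorSum (gyLevel k N) (primorial (w N) * x.val + 1) ^ 2 /
        Real.log (gyLevel k N)
  else 1

/-! ### Named facts: Propositions 9.5, 9.6 (Goldston–Yıldırım) and 9.8, 9.10 -/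

/-- **Green–Tao 2008, Proposition 9.5 (Goldston–Yıldırım).** Let `k ≥ 3` (standing, Def. 9.3),
`m, t ≥ 1`, `ψ_i(x) = ∑_{j ≤ t} L_{ij} x_j + b_i` (`i ≤ m`) integer affine-linear forms with
`|L_{ij}| ≤ √(w(N))/2`, no row `(L_{ij})_j` zero and no two rows rational multiples of each
other, `θ_i = W ψ_i + 1`, and `B = ∏_{j ≤ t} I_j` a product of intervals each of length
`≥ R^{10m}` (`R = N^{k⁻¹2^{-k-4}}`, `W = ∏_{p ≤ w(N)} p`). Then, if `w(N) → ∞` sufficiently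
slowly, `E(Λ_R(θ_1(x))² ⋯ Λ_R(θ_m(x))² | x ∈ B) = (1 + o_{m,t}(1)) (W log R / φ(W))^m` for
large prime `N`, uniformly in the data (`L`, `b`, `B`) — here for boxes with integer corners
`a_j` and integer side lengths `ℓ_j ≥ R^{10m}`. Proved in §10 + Appendix (contour integration
against `ζ`). Named fact. [cite: GreenTaoAnnals2008, Proposition 9.5] -/
def GoldstonYildirimLinearForms : Prop :=
  ∀ k m t : ℕ, 3 ≤ k → 1 ≤ m → 1 ≤ t → ∃ G : ℕ → ℕ, Tendsto G atTop atTop ∧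
    ∀ w : ℕ → ℕ, Tendsto w atTop atTop → (∀ N, w N ≤ G N) →
      ∀ ε : ℝ, 0 < ε → ∀ᶠ N : ℕ in atTop, N.Prime →
        ∀ L : Fin m → Fin t → ℤ, (∀ i j, (|L i j| : ℝ) ≤ Real.sqrt (w N) / 2) → (∀ i, L i ≠ 0) →
          (∀ i i', i ≠ i' → ∀ c : ℚ, (fun j => (L i j : ℚ)) ≠ c • fun j => (L i' j : ℚ)) →
          ∀ b : Fin m → ℤ, ∀ a : Fin t → ℤ, ∀ ℓ : Fin t → ℕ,
            (∀ j, gyLevel k N ^ (10 * m) ≤ ℓ j) →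
            |(𝔼 x ∈ Fintype.piFinset fun j => Ico (a j) (a j + ℓ j),
                ∏ i, truncatedDivisorSum (gyLevel k N)
                  (primorial (w N) * (∑ j, L i j * x j + b i) + 1) ^ 2) /
              ((primorial (w N) : ℝ) * Real.log (gyLevel k N) /
                Nat.totient (primorial (w N))) ^ m - 1| ≤ ε

/-- **Green–Tao 2008, Proposition 9.6 (Goldston–Yıldırım).** Let `k ≥ 3` (standing, Def. 9.3),
`m ≥ 1`, `B` an interval of length `≥ R^{10m}`, `h_1, …, h_m` distinct integers with
`|h_i| ≤ N²`, and `Δ = ∏_{i<j} |h_i - h_j|`. Then, for `N` a large prime (depending on `m`) and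
`w(N) → ∞` sufficiently slowly, `E(Λ_R(W(x+h_1)+1)² ⋯ Λ_R(W(x+h_m)+1)² | x ∈ B)
  ≤ (1 + o_m(1)) (W log R/φ(W))^m ∏_{p ∣ Δ} (1 + O_m(p^{-1/2}))`
(the implied constant written `C`; here for integer intervals `[a, a + ℓ)`, `ℓ ≥ R^{10m}`).
Proved in §10 + Appendix. Named fact. [cite: GreenTaoAnnals2008, Proposition 9.6] -/
def GoldstonYildirimCorrelations : Prop :=
  ∀ k m : ℕ, 3 ≤ k → 1 ≤ m → ∃ C : ℝ, 0 ≤ C ∧ ∃ G : ℕ → ℕ, Tendsto G atTop atTop ∧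
    ∀ w : ℕ → ℕ, Tendsto w atTop atTop → (∀ N, w N ≤ G N) →
      ∀ ε : ℝ, 0 < ε → ∀ᶠ N : ℕ in atTop, N.Prime →
        ∀ h : Fin m → ℤ, Function.Injective h → (∀ i, |h i| ≤ (N : ℤ) ^ 2) →
          ∀ a : ℤ, ∀ ℓ : ℕ, gyLevel k N ^ (10 * m) ≤ ℓ →
            𝔼 x ∈ Ico a (a + ℓ), ∏ i, truncatedDivisorSum (gyLevel k N)
                (primorial (w N) * (x + h i) + 1) ^ 2 ≤
              (1 + ε) * ((primorial (w N) : ℝ) * Real.log (gyLevel k N) /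
                  Nat.totient (primorial (w N))) ^ m *
                ∏ p ∈ (∏ i, ∏ j ∈ univ.filter (fun j => i < j), |h i - h j|).natAbs.primeFactors,
                  (1 + C * (p : ℝ) ^ (-(1 / 2 : ℝ)))

/-- **Green–Tao 2008, Proposition 9.8.** The measure `ν` of Definition 9.3 satisfies the
`(k 2^{k-1}, 3k-4, k)`-linear forms condition (for `k ≥ 3`, `w(N) → ∞` sufficiently slowly —
rendered by a growth bound `G`). Printed proof (pp. 526–528): clear denominators, chop `ℤ_N^t`
into `Q^t` boxes, apply Prop. 9.5 on "nice" boxes, bound the proportion of non-nice boxes by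
`O(1/Q)`. Named fact here; its derivation from `GoldstonYildirimLinearForms` is the business of
the sibling PROOFS file. [cite: GreenTaoAnnals2008, Proposition 9.8] -/
def MeasureLinearForms : Prop :=
  ∀ k : ℕ, 3 ≤ k → ∃ G : ℕ → ℕ, Tendsto G atTop atTop ∧
    ∀ w : ℕ → ℕ, Tendsto w atTop atTop → (∀ N, w N ≤ G N) →
      LinearFormsCondition (k * 2 ^ (k - 1)) (3 * k - 4) k (gtMeasure k w)

/-- **Green–Tao 2008, Proposition 9.10.** The measure `ν` of Definition 9.3 satisfies the
`2^{k-1}`-correlation condition (for `k ≥ 3`, `w(N) → ∞` sufficiently slowly — rendered by a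
growth bound `G`). Printed proof (pp. 528–530): Lemma 9.9 (the weight
`τ_m(n) = O_m(1) ∏_{p ∣ n} (1 + p^{-1/2})^{O_m(1)}` has bounded moments), the divisor bound
`‖ν‖_∞ ≪ exp(C log N / log log N)` for coincident shifts, and Prop. 9.6 for distinct shifts.
Named fact here; its derivation from `GoldstonYildirimCorrelations` is the business of the
sibling PROOFS file. [cite: GreenTaoAnnals2008, Proposition 9.10] -/
def MeasureCorrelation : Prop :=
  ∀ k : ℕ, 3 ≤ k → ∃ G : ℕ → ℕ, Tendsto G atTop atTop ∧
    ∀ w : ℕ → ℕ, Tendsto w atTop atTop → (∀ N, w N ≤ G N) →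
      CorrelationCondition (2 ^ (k - 1)) (gtMeasure k w)

/-! ### API for Definitions 9.2 / 9.3 -/

/-- Unfolding `Λ_R`. [cite: GreenTaoAnnals2008, Definition 9.2] -/
theorem truncatedDivisorSum_def (R : ℝ) (n : ℤ) :
    truncatedDivisorSum R n = ∑ d ∈ (Icc 1 ⌊R⌋₊).filter (fun d : ℕ => (d : ℤ) ∣ n),
      (ArithmeticFunction.moebius d : ℝ) * Real.log (R / d) := rfl

/-- `Λ_R(-n) = Λ_R(n)` (only divisibility enters). [cite: GreenTaoAnnals2008, Definition 9.2] -/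
theorem truncatedDivisorSum_neg (R : ℝ) (n : ℤ) :
    truncatedDivisorSum R (-n) = truncatedDivisorSum R n := by
  unfold truncatedDivisorSum
  congr 1
  ext d
  simp only [mem_filter, dvd_neg]

/-- The heart of Lemma 9.4: for a prime `p > R ≥ 1` the sum defining `Λ_R(p)` has the single
term `d = 1`, so `Λ_R(p) = log R`. [cite: GreenTaoAnnals2008, Lemma 9.4 (proof)] -/
theorem truncatedDivisorSum_prime {R : ℝ} {p : ℕ} (hp : p.Prime) (hR : 1 ≤ R)
    (hpR : R < p) : truncatedDivisorSum R p = Real.log R := by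
  unfold truncatedDivisorSum
  have hset : (Icc 1 ⌊R⌋₊).filter (fun d : ℕ => (d : ℤ) ∣ (p : ℤ)) = {1} := by
    ext d
    simp only [mem_filter, mem_Icc, mem_singleton]
    constructor
    · rintro ⟨⟨-, h2⟩, hd⟩
      have hd' : d ∣ p := Int.natCast_dvd_natCast.1 hd
      rcases (Nat.dvd_prime hp).1 hd' with h | h
      · exact h
      · exfalso
        rw [h] at h2
        have h3 : (p : ℝ) ≤ ⌊R⌋₊ := by exact_mod_cast h2
        linarith [Nat.floor_le (show (0 : ℝ) ≤ R by linarith)]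
    · rintro rfl
      exact ⟨⟨le_rfl, Nat.le_floor (by exact_mod_cast hR)⟩, by simp⟩
  rw [hset, sum_singleton]
  simp

/-- Unfolding the level `R`. [cite: GreenTaoAnnals2008, Definition 9.3] -/
theorem gyLevel_def (k N : ℕ) : gyLevel k N = (N : ℝ) ^ ((k : ℝ)⁻¹ * 2⁻¹ ^ (k + 4)) := rfl

/-- `R ≥ 0`. [cite: GreenTaoAnnals2008, Definition 9.3] -/
theorem gyLevel_nonneg (k N : ℕ) : 0 ≤ gyLevel k N :=
  Real.rpow_nonneg (Nat.cast_nonneg _) _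

/-- `R ≥ 1` once `N ≥ 1`. [cite: GreenTaoAnnals2008, Definition 9.3] -/
theorem one_le_gyLevel {k N : ℕ} (hN : 1 ≤ N) : 1 ≤ gyLevel k N :=
  Real.one_le_rpow (by exact_mod_cast hN) (by positivity)

/-- `log R ≥ 0` (for every `N`; `log 0 = 0` in Mathlib). [cite: GreenTaoAnnals2008, Definition 9.3] -/
theorem log_gyLevel_nonneg (k N : ℕ) : 0 ≤ Real.log (gyLevel k N) := by
  rcases Nat.eq_zero_or_pos N with rfl | hN
  · unfold gyLevel
    by_cases he : ((k : ℝ)⁻¹ * 2⁻¹ ^ (k + 4)) = 0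
    · rw [he, Real.rpow_zero, Real.log_one]
    · rw [Nat.cast_zero, Real.zero_rpow he, Real.log_zero]
  · exact Real.log_nonneg (one_le_gyLevel hN)

/-- `log R = k⁻¹ 2^{-k-4} log N`. [cite: GreenTaoAnnals2008, Definition 9.3] -/
theorem log_gyLevel (k N : ℕ) :
    Real.log (gyLevel k N) = (k : ℝ)⁻¹ * 2⁻¹ ^ (k + 4) * Real.log N := by
  rcases Nat.eq_zero_or_pos N with rfl | hN
  · have h0 : Real.log (gyLevel k 0) = 0 := by
      have := log_gyLevel_nonneg k 0
      unfold gyLevel at this ⊢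
      by_cases he : ((k : ℝ)⁻¹ * 2⁻¹ ^ (k + 4)) = 0
      · rw [he, Real.rpow_zero, Real.log_one]
      · rw [Nat.cast_zero, Real.zero_rpow he, Real.log_zero]
    simp [h0]
  · unfold gyLevel
    exact Real.log_rpow (by exact_mod_cast hN) _

/-- `R = N^{k⁻¹2^{-k-4}} = o(N)`: precisely `R / N → 0` (`k ≥ 1`).
[cite: GreenTaoAnnals2008, Definition 9.3] -/
theorem tendsto_gyLevel_div_atTop {k : ℕ} (hk : 1 ≤ k) :
    Tendsto (fun N : ℕ => gyLevel k N / N) atTop (𝓝 0) := by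
  set e : ℝ := (k : ℝ)⁻¹ * 2⁻¹ ^ (k + 4) with he_def
  have he1 : e < 1 := by
    have h1 : (k : ℝ)⁻¹ ≤ 1 := inv_le_one_of_one_le₀ (by exact_mod_cast hk)
    have h2 : (2⁻¹ : ℝ) ^ (k + 4) < 1 := pow_lt_one₀ (by norm_num) (by norm_num) (by omega)
    calc e ≤ 1 * 2⁻¹ ^ (k + 4) := by rw [he_def]; gcongr
      _ < 1 := by simpa using h2
  have h := (tendsto_rpow_neg_atTop (show 0 < 1 - e by linarith)).comp
    (tendsto_natCast_atTop_atTop (R := ℝ))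
  refine h.congr' ?_
  filter_upwards [eventually_ge_atTop 1] with N hN
  have hN0 : (0 : ℝ) < N := by exact_mod_cast hN
  show ((N : ℝ)) ^ (-(1 - e)) = gyLevel k N / N
  rw [gyLevel_def, ← he_def, Real.rpow_neg hN0.le, Real.rpow_sub hN0, Real.rpow_one, inv_div]

/-! ### Lemma 9.4: `ν ≥ 0` and `ν` majorises `k⁻¹ 2^{-k-5} Λ̃` on `[ε_k N, 2ε_k N]` -/

/-- **Green–Tao 2008, Lemma 9.4, first claim:** `ν(n) ≥ 0`.
[cite: GreenTaoAnnals2008, Lemma 9.4] -/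
theorem gtMeasure_nonneg (k : ℕ) (w : ℕ → ℕ) (N : ℕ) (x : ZMod N) : 0 ≤ gtMeasure k w N x := by
  unfold gtMeasure
  split_ifs
  · exact div_nonneg (mul_nonneg (div_nonneg (Nat.cast_nonneg _) (Nat.cast_nonneg _))
      (sq_nonneg _)) (log_gyLevel_nonneg k N)
  · exact zero_le_one

/-- `ν` on the window, for a natural number `n < N` read in `ℤ_N`.
[cite: GreenTaoAnnals2008, Definition 9.3] -/
theorem gtMeasure_natCast_of_mem {k : ℕ} {w : ℕ → ℕ} {N n : ℕ} (hnN : n < N)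
    (h1 : eps k * N ≤ n) (h2 : (n : ℝ) ≤ 2 * eps k * N) :
    gtMeasure k w N (n : ZMod N) =
      (Nat.totient (primorial (w N)) : ℝ) / primorial (w N) *
        truncatedDivisorSum (gyLevel k N) (primorial (w N) * n + 1) ^ 2 /
          Real.log (gyLevel k N) := by
  haveI : NeZero N := ⟨by omega⟩
  have hv : (n : ZMod N).val = n := ZMod.val_cast_of_lt hnN
  unfold gtMeasure
  rw [hv, if_pos ⟨h1, h2⟩]

/-- `ν` off the window equals `1`, for a natural number `n < N` read in `ℤ_N`.
[cite: GreenTaoAnnals2008, Definition 9.3] -/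
theorem gtMeasure_natCast_of_not_mem {k : ℕ} {w : ℕ → ℕ} {N n : ℕ} (hnN : n < N)
    (h : ¬ (eps k * N ≤ n ∧ (n : ℝ) ≤ 2 * eps k * N)) :
    gtMeasure k w N (n : ZMod N) = 1 := by
  haveI : NeZero N := ⟨by omega⟩
  have hv : (n : ZMod N).val = n := ZMod.val_cast_of_lt hnN
  unfold gtMeasure
  rw [hv, if_neg h]

/-- **Green–Tao 2008, Lemma 9.4, second claim (quantitative form):**
`ν(n) ≥ k⁻¹ 2^{-k-5} Λ̃(n)` for `ε_k N ≤ n ≤ 2 ε_k N`, as soon as `R < ε_k N` ("`W n + 1 > R`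
if `N` is sufficiently large", as `W n + 1 > n ≥ ε_k N`), `R ≥ 1`, and `W ≤ N` (the instance of
"`w(N)` sufficiently slowly growing" that makes `W n + 1 ≤ N²`, i.e.
`k⁻¹2^{-k-5} log(W n + 1) ≤ k⁻¹ 2^{-k-4} log N = log R`). Proof as printed: if `W n + 1` is
not prime both sides vanish or `ν ≥ 0`; if it is a prime `p > R` then `Λ_R(p) = log R` and
`ν(n) = (φ(W)/W) log R`. [cite: GreenTaoAnnals2008, Lemma 9.4] -/
theorem gtMeasure_majorises {k : ℕ} (hk : 1 ≤ k) {w : ℕ → ℕ} {N n : ℕ}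
    (hWN : primorial (w N) ≤ N) (hR1 : 1 ≤ gyLevel k N) (hRε : gyLevel k N < eps k * N)
    (h1 : eps k * N ≤ n) (h2 : (n : ℝ) ≤ 2 * eps k * N) :
    (k : ℝ)⁻¹ * 2⁻¹ ^ (k + 5) * modifiedVonMangoldt (primorial (w N)) n ≤
      gtMeasure k w N (n : ZMod N) := by
  set W : ℕ := primorial (w N) with hW_def
  have hW0 : 0 < W := primorial_pos _
  have hN0 : (0 : ℝ) < N := by
    have h0 : 0 < eps k * N := lt_of_le_of_lt (gyLevel_nonneg k N) hRε
    by_contra h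
    push Not at h
    have : eps k * N ≤ 0 := mul_nonpos_of_nonneg_of_nonpos (eps_pos k).le h
    linarith
  have hnN' : (n : ℝ) < N := by
    have := two_mul_eps_lt_one k
    calc (n : ℝ) ≤ 2 * eps k * N := h2
      _ < 1 * N := by gcongr
      _ = N := one_mul _
  have hnN : n < N := by exact_mod_cast hnN'
  by_cases hp : (W * n + 1).Prime
  · -- `W n + 1 = p` prime, `p > n ≥ ε N > R`
    have hpR : gyLevel k N < ((W * n + 1 : ℕ) : ℝ) := by
      have h3 : (n : ℝ) ≤ W * n := by
        have : (1 : ℝ) ≤ W := by exact_mod_cast hW0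
        nlinarith [Nat.cast_nonneg (α := ℝ) n]
      push_cast
      linarith
    have hΛ : truncatedDivisorSum (gyLevel k N) (W * n + 1 : ℕ) = Real.log (gyLevel k N) :=
      truncatedDivisorSum_prime hp hR1 hpR
    rw [gtMeasure_natCast_of_mem hnN h1 h2, modifiedVonMangoldt_eq, if_pos hp]
    have hcast : ((W : ℤ) * (n : ℤ) + 1 : ℤ) = ((W * n + 1 : ℕ) : ℤ) := by push_cast; ring
    rw [hcast, hΛ]
    -- goal: c (φ/W) log(Wn+1) ≤ (φ/W) (log R)^2 / log R
    have hlogR : 0 < Real.log (gyLevel k N) := by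
      -- `R > 0`-window: `R ≥ 1`; if `R = 1` then `log R = 0`… but `R < ε N ≤ n < W n + 1` and we
      -- only need `log R > 0` to cancel; derive it from `log R = k⁻¹2^{-k-4} log N`, `N ≥ 2`.
      rw [log_gyLevel]
      have hN2 : (2 : ℝ) ≤ N := by
        have : 1 < N := by
          by_contra h
          push Not at h
          -- `N ≤ 1`, `n < N` ⇒ `n = 0` ⇒ `ε N ≤ 0` contradiction with `R ≥ 1 > … `: use `hRε`, `h1`
          have hn0 : n = 0 := by omega
          subst hn0
          have : eps k * N ≤ 0 := by exact_mod_cast h1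
          linarith [lt_of_le_of_lt (gyLevel_nonneg k N) hRε]
        exact_mod_cast this
      have : 0 < Real.log N := Real.log_pos (by linarith)
      positivity
    have hφ : 0 ≤ (Nat.totient W : ℝ) / W := by positivity
    have hlogp : Real.log ((W : ℝ) * n + 1) ≤ 2 * Real.log N := by
      have hle : (W : ℝ) * n + 1 ≤ (N : ℝ) ^ 2 := by
        have hW' : (W : ℝ) ≤ N := by exact_mod_cast hWN
        have hn1 : (n : ℝ) + 1 ≤ N := by exact_mod_cast hnN
        nlinarith [Nat.cast_nonneg (α := ℝ) n, Nat.cast_nonneg (α := ℝ) W]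
      calc Real.log ((W : ℝ) * n + 1) ≤ Real.log ((N : ℝ) ^ 2) :=
            Real.log_le_log (by positivity) hle
        _ = 2 * Real.log N := by rw [Real.log_pow]; norm_num
    -- `k⁻¹ 2^{-k-5} log(W n + 1) ≤ k⁻¹ 2^{-k-5} · 2 log N = log R`
    have hkey : (k : ℝ)⁻¹ * 2⁻¹ ^ (k + 5) * Real.log ((W : ℝ) * n + 1) ≤
        Real.log (gyLevel k N) := by
      rw [log_gyLevel]
      calc (k : ℝ)⁻¹ * 2⁻¹ ^ (k + 5) * Real.log ((W : ℝ) * n + 1)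
          ≤ (k : ℝ)⁻¹ * 2⁻¹ ^ (k + 5) * (2 * Real.log N) := by gcongr
        _ = (k : ℝ)⁻¹ * 2⁻¹ ^ (k + 4) * Real.log N := by ring
    calc (k : ℝ)⁻¹ * 2⁻¹ ^ (k + 5) * ((Nat.totient W : ℝ) / W * Real.log ((W : ℝ) * n + 1))
        = (Nat.totient W : ℝ) / W * ((k : ℝ)⁻¹ * 2⁻¹ ^ (k + 5) * Real.log ((W : ℝ) * n + 1)) := by
          ring
      _ ≤ (Nat.totient W : ℝ) / W * Real.log (gyLevel k N) := by gcongr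
      _ = (Nat.totient W : ℝ) / W * Real.log (gyLevel k N) ^ 2 / Real.log (gyLevel k N) := by
          field_simp
  · -- `W n + 1` not prime: `Λ̃(n) = 0 ≤ ν(n)`
    rw [modifiedVonMangoldt_eq, if_neg hp, mul_zero]
    exact gtMeasure_nonneg k w N _

/-! ### Assembly: Proposition 9.1 from Propositions 9.8 and 9.10 (and Lemma 9.4) -/

/-- **Green–Tao 2008, "Proof of Proposition 9.1" (p. 530)** relative to Propositions 9.8 and
9.10: "This is immediate from Lemmas 9.4 and 9.7, Propositions 9.8 and 9.10 and the definition
of `k`-pseudorandom measure, which is Definition 3.3." Here with the growth bound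
`G = min(G_{9.8}, G_{9.10}, ⌊log_4 log N⌋)` (the last term gives `W ≤ 4^w ≤ log N ≤ N`, the
slowness used in Lemma 9.4), the majorant being `ν = gtMeasure k w` of Definition 9.3; Lemma 9.7
(`E(ν) = 1 + o(1)`) is the case `m = t = 1` of the linear forms condition and is not a separate
clause of `IsPseudorandom`. (`min` of sequences tending to `∞`: Mathlib's `tendsto_inf_atTop`.)
[cite: GreenTaoAnnals2008, Proposition 9.1 (proof, p. 530)] -/
theorem PseudorandomMajorant_of (h₈ : MeasureLinearForms) (h₁₀ : MeasureCorrelation) :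
    PseudorandomMajorant := by
  intro k hk
  obtain ⟨G₁, hG₁, H₁⟩ := h₈ k hk
  obtain ⟨G₂, hG₂, H₂⟩ := h₁₀ k hk
  have hfl : Tendsto (fun N : ℕ => ⌊Real.logb 4 (Real.log N)⌋₊) atTop atTop :=
    tendsto_nat_floor_atTop.comp ((Real.tendsto_logb_atTop (by norm_num)).comp
      (Real.tendsto_log_atTop.comp tendsto_natCast_atTop_atTop))
  refine ⟨fun N => min (min (G₁ N) (G₂ N)) ⌊Real.logb 4 (Real.log N)⌋₊,
    tendsto_inf_atTop atTop (tendsto_inf_atTop atTop hG₁ hG₂) hfl, fun w hw hwG => ?_⟩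
  have hw₁ : ∀ N, w N ≤ G₁ N := fun N => (hwG N).trans ((min_le_left _ _).trans (min_le_left _ _))
  have hw₂ : ∀ N, w N ≤ G₂ N := fun N => (hwG N).trans ((min_le_left _ _).trans (min_le_right _ _))
  have hw₃ : ∀ N, w N ≤ ⌊Real.logb 4 (Real.log N)⌋₊ := fun N => (hwG N).trans (min_le_right _ _)
  refine ⟨gtMeasure k w, ⟨gtMeasure_nonneg k w, H₁ w hw hw₁, H₂ w hw hw₂⟩, ?_⟩
  -- Lemma 9.4, for `N` large: `R ≥ 1`, `R < ε_k N`, `W ≤ log N ≤ N`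
  have hk1 : 1 ≤ k := by omega
  have hRε : ∀ᶠ N : ℕ in atTop, gyLevel k N < eps k * N := by
    filter_upwards [(tendsto_gyLevel_div_atTop hk1).eventually (gt_mem_nhds (eps_pos k)),
      eventually_ge_atTop 1] with N hN hN1
    have hN0 : (0 : ℝ) < N := by exact_mod_cast hN1
    rwa [div_lt_iff₀ hN0] at hN
  filter_upwards [hRε, eventually_ge_atTop 3] with N hRεN hN3 _hNp n h1 h2
  have hN3' : (3 : ℝ) ≤ N := by exact_mod_cast hN3
  have hWN : primorial (w N) ≤ N := by
    have h := primorial_le_log hN3 (hw₃ N)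
    have hlog : Real.log N ≤ N := (Real.log_le_sub_one_of_pos (by linarith)).trans (by linarith)
    exact_mod_cast h.trans hlog
  exact gtMeasure_majorises hk1 hWN (one_le_gyLevel (by omega)) hRεN h1 h2

end Literature.NumberTheory.Sieve.GreenTao2008
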